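import Summits.HodgeConjecture.HodgeConjecture.Theorems.MarkmanPartnerTransportPicardThreeK3SquaresCMThird
import Summits.HodgeConjecture.HodgeConjecture.Theses.ELineTransport
import Literature.AlgebraicGeometry.Motives.HodgeStructureK3RealMultProofs
import Literature.AlgebraicGeometry.Motives.HodgeStructureK3TypeProofs

/-!
# Route MarkmanPartnerTransport · crux `PicardThreeK3Squares` (stmt-HodgeConjecture-19652) —
# Picard number `≥ 17`: no real multiplication (van Geemen), so the crux holds there modulo Buskin

Zarhin: `E = End_Hdg(T(S)_ℚ)` of a projective K3 surface `S` is a totally real or a CM field; van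
Geemen 2008, Lemma 3.2: in the totally real case `dim_E T(S) ≥ 3`. Hence for `ρ(S) ≥ 17`
(`rank T(S) = 22 - ρ(S) ≤ 5`) real multiplication is impossible: `E = ℚ` or `E` is CM. Both named
facts are THEOREMS of the tree on the abstract carriers (`Zarhin1983_endAlg_isField_holds`,
`Zarhin1983_adjoint_eq_conj_holds`, `Vangeemen2008_three_mul_finrank_endAlg_le_holds`, with the
consequence `….endAlg_eq_bot_or_exists_conj_ne`); this file transports them to the cohomology of `S`
through a marking (the transcendental Hodge structure `hodgeT` on `T = N_ℚ^⊥ ≤ Λ_ℚ` of the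
AnchorTransport CM floor, `…CMFloorTranscendental/Polarization/Span`) and concludes:

* `scalar_or_hasComplexMultiplication_of_seventeen_le` — for a projective K3 surface with
  `17 ≤ ρ(S) = dim_ℂ N¹H²`, EITHER every rational Hodge endomorphism of `H²(S(ℂ); ℂ)` killing `N¹`
  with image in `T` is a rational scalar on `T` (`End_Hdg(T) = ℚ`), OR `S` has complex multiplication
  (`HasComplexMultiplication S`: a rational Hodge endomorphism with a non-real eigenvalue on
  `H^{2,0}`) — granted the existence of markings (`Huybrechts_K3_marking_exists`).
* `hodgeConjectureFor_square_of_seventeen_le` — **HC for `S × S`, `ρ(S) ≥ 17`, modulo Buskin's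
  Thm. 1.1 and markings** (`E = ℚ`: the tree theorem
  `hodgeConjectureFor_square_of_hodgeEndomorphisms_scalar`; CM: `CMThird.hodgeConjectureFor_square_of_CM_of_buskin`).
* `highPicardSquares_of_buskin` — the support item `ELineTransport.HighPicardSquares`
  (stmt-HodgeConjecture-12553) modulo the same two named facts.
* `picardThreeK3Squares_of_realMultiplicationThird_le_sixteen` — the crux `PicardThreeK3Squares`
  reduced (mod Buskin Thm. 1.1 + markings) to the cycle-induced sector clause on non-CM, non-scalar
  K3 surfaces with `3 ≤ ρ(S) ≤ 16` (sharpening `CMThird.picardThreeK3Squares_of_realMultiplicationThird`).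

No definition, no sorry; named facts only as hypotheses. Prover seat hodge-nonav-19652-p1 (gen 0),
`--supports stmt-HodgeConjecture-19652`.

References: van Geemen, Michigan Math. J. 56 (2008), Lemma 3.2; Zarhin, J. reine angew. Math. 341
(1983), Thm. 1.5.1; Huybrechts, *Lectures on K3 Surfaces*, Ch. 3 Lemma 3.3.1, Thm. 3.3.7; Buskin,
J. reine angew. Math. 755 (2019), Thm. 1.1 and Corollary.
-/

set_option linter.dupNamespace false

noncomputable section

namespace Summit.HodgeConjecture.HodgeConjecture.Theorems.MarkmanPartnerTransport.HighPicard

open scoped Manifold TensorProduct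
open Module CategoryTheory MonoidalCategory CartesianMonoidalCategory
open Literature.AlgebraicGeometry Literature.AlgebraicGeometry.Motives Literature.AlgebraicGeometry.HodgeTheory
open Literature.AlgebraicGeometry.Motives.HodgeStructure
open Literature.AlgebraicGeometry.Surfaces
open Literature.AlgebraicTopology.SingularHomology
open Summit.HodgeConjecture.HodgeConjecture.Theorems
open Summit.HodgeConjecture.HodgeConjecture.Theorems.NikulinTwinTransport
open Summit.HodgeConjecture.HodgeConjecture.Theorems.AnchorExistenceCMFloor

variable {S : SchemeOver ℂ}

/-- `Corr[μ, hS ; γ, y] = pr₁_*(pr₂^* y ∪ γ)` on `H²(S(ℂ); ℂ)`. Local notation only. -/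
local notation3 (prettyPrint := false) "Corr[" μ ", " hS " ; " γ ", " y "]" =>
  complexGysin μ (IsSmoothProjective.tensor_holds hS hS) hS
    (SemiCartesianMonoidalCategory.fst _ _) (rfl : 2 * 1 + 2 * 2 + 2 * 2 = 2 * 1 + 2 * (2 + 2))
    (cupProduct (rfl : 2 * 1 + 2 * 2 = 2 * 1 + 2 * 2)
      (complexBetti.map (SemiCartesianMonoidalCategory.snd _ _) (2 * 1) y) γ)

/-! ### Picard number `≥ 17`: `End_Hdg(T(S)) = ℚ` or complex multiplication -/

/-- **For a projective K3 surface of Picard number `≥ 17`, `End_Hdg(T(S))` is `ℚ` or `S` has complex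
multiplication** (granted markings). Read through a marking `η : H²(S(ℂ); ℂ) ≃ Λ_ℂ`: the rational
`(1,1)`-vectors `N_ℚ ≤ Λ_ℚ` (`= η(N¹H²) ∩ Λ_ℚ`, Lefschetz `(1,1)` and `N¹ ⊆ F¹`) satisfy
`N_ℚ ∩ N_ℚ^⊥ = 0` (Hodge index) and `dim_ℚ N_ℚ ≥ dim_ℂ N¹H² ≥ 17`, so `T = N_ℚ^⊥` has `dim_ℚ T ≤ 5`
(`dim Λ_ℚ = 22`); the transcendental Hodge structure on `T` (`hodgeT`, irreducible of K3 type,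
polarized by `-( . )|_T`) then has `End_Hdg(T) = ℚ` or a non-real embedding (van Geemen's Lemma 3.2 +
Zarhin, tree theorems). In the first case a rational Hodge endomorphism `f` of `H²(S)` killing `N¹`
restricts on `T` to an element of `End_Hdg(T) = ℚ` (`restrict_mem_endAlg`), so `f = a` on `T`; in the
second, by Zarhin's adjoint theorem some `a ∈ End_Hdg(T)` acts on `T^{2,0} = ℂ ω` by a non-real
scalar, and `η⁻¹ ∘ (a ⊕ id_N)_ℂ ∘ η` (`extendT`) is a rational Hodge endomorphism of `H²(S)` with that
eigenvalue on `H^{2,0}`. [cite: Vangeemen2008, Lemma 3.2] [cite: Zarhin1983HodgeGroupsK3, Thm. 1.5.1]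
[cite: Huybrechts2016K3, Ch. 3 Lemma 3.3.1 and Thm. 3.3.7] -/
theorem scalar_or_hasComplexMultiplication_of_seventeen_le (hmark : Huybrechts_K3_marking_exists)
    (hS : IsK3Surface S) (hρ : 17 ≤ Module.finrank ℂ ↥(algebraicClasses S 1)) :
    (∀ (f : complexBetti S (2 * 1) →ₗ[ℂ] complexBetti S (2 * 1)),
      (∀ y, IsRationalClass y → IsRationalClass (f y)) →
      (∀ (i j : ℕ) y, IsOfHodgeType 2 S (2 * 1) i j y → IsOfHodgeType 2 S (2 * 1) i j (f y)) →
      (∀ d ∈ algebraicClasses S 1, f d = 0) →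
      (∀ y : complexBetti S (2 * 1), ∀ d ∈ algebraicClasses S 1,
        cupProduct (rfl : 2 * 1 + 2 * 1 = 2 * 2) (f y) d = 0) →
      ∃ a : ℚ, ∀ y : complexBetti S (2 * 1),
        (∀ d ∈ algebraicClasses S 1, cupProduct (rfl : 2 * 1 + 2 * 1 = 2 * 2) y d = 0) →
          f y = (a : ℂ) • y) ∨
    HasComplexMultiplication S := by
  classical
  have hHT : Huybrechts_K3_hodgeTypes_H2 := Huybrechts_K3_hodgeTypes_H2_holds
  obtain ⟨η, p₀, x, hp₀, ⟨hp₀int, hp₀gen, hηint, hηcup, hx20, hx20'⟩, hxx, hxpos, hu⟩ := hmark S hS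
  set N := algebraicClasses S 1 with hNdef
  set σ := η.symm x with hσdef
  have hησ : η σ = x := by rw [hσdef, LinearEquiv.apply_symm_apply]
  have hxne : σ ≠ 0 := by
    intro h0
    have hx : x = 0 := by rw [← hησ, h0, map_zero]
    subst hx
    simp [k3Form] at hxpos
  obtain ⟨h₁, -, h₃⟩ := hHT S hS σ hx20 hxne
  have hσbar : conjClass (ComplexPoints S) (2 * 1) σ = η.symm (star x) := conjClass_marking_symm η hηint x
  have hsmul0 : ∀ {c : ℂ}, c • p₀ = 0 → c = 0 := fun h => by
    rcases smul_eq_zero.1 h with h | h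
    · exact h
    · exact absurd h hp₀
  have hL11 : ∀ c : complexBetti S (2 * 1), IsRationalClass c → IsOfHodgeType 2 S (2 * 1) 1 1 c → c ∈ N :=
    fun c hc h11 => lefschetzOneOne_rational_holds hS.1 c hc h11
  have hND : ∀ c ∈ N, IsRationalClass c →
      (∀ d ∈ N, cupProduct (rfl : 2 * 1 + 2 * 1 = 2 * 2) c d = 0) → c = 0 :=
    fun c hcN hc hperp => anchorExistence_cmFloor_divisorClass_eq_zero_of_hodgeIndex
      hodgeIndex_surface_holds lefschetzOneOne_rational_holds
      Grothendieck1969_supportedClasses_le_hodgeConiveau_holds hS hcN hc hperp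
  -- rational classes are `Λ_ℚ`
  have hrat : ∀ c, IsRationalClass c ↔ ∃ w : K3Index → ℚ, η c = fun i => (w i : ℂ) :=
    isRationalClass_iff_of_marking hS η hηint
  -- the rational points of `N`
  let NQ : Submodule ℚ (K3Index → ℚ) :=
    { carrier := {u | η.symm (fun j => (u j : ℂ)) ∈ N}
      add_mem' := fun {u v} hu hv => by
        simp only [Set.mem_setOf_eq, ratCastΛ_add, map_add]
        exact N.add_mem hu hv
      zero_mem' := by
        simp only [Set.mem_setOf_eq, ratCastΛ_zero, map_zero]
        exact N.zero_mem
      smul_mem' := fun q u hu => by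
        simp only [Set.mem_setOf_eq, ratCastΛ_smul, map_smul]
        exact N.smul_mem _ hu }
  have memNQ : ∀ u, u ∈ NQ ↔ η.symm (fun j => (u j : ℂ)) ∈ N := fun u => Iff.rfl
  -- `(1,1)`-classes through the marking
  have h11_iff : ∀ v : K3Index → ℂ, IsOfHodgeType 2 S (2 * 1) 1 1 (η.symm v) ↔
      (k3Form v x = 0 ∧ k3Form v (star x) = 0) := by
    intro v
    rw [h₃ (η.symm v), hηcup, hηcup, LinearEquiv.apply_symm_apply, hησ, hσbar, LinearEquiv.apply_symm_apply]
    constructor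
    · rintro ⟨ha, hb⟩
      exact ⟨hsmul0 ha, hsmul0 hb⟩
    · rintro ⟨ha, hb⟩
      rw [ha, hb, zero_smul]
      exact ⟨rfl, rfl⟩
  -- `N_ℚ = Λ_ℚ ∩ {x, x̄}^⊥`
  have hN : ∀ u : K3Index → ℚ, u ∈ NQ ↔
      (k3Form (fun i => (u i : ℂ)) x = 0 ∧ k3Form (fun i => (u i : ℂ)) (star x) = 0) := by
    intro u
    rw [memNQ, ← h11_iff]
    constructor
    · intro hu
      exact isOfHodgeType_of_mem_algebraicClasses_of_isSmoothProjective hS.1 1 hu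
    · intro hu
      exact hL11 _ ((hrat _).2 ⟨u, LinearEquiv.apply_symm_apply _ _⟩) hu
  -- `N` is spanned by its rational classes, so `N_ℚ^⊥ ⊗ ℂ ⊥ N`
  have hspan := span_isRationalClass_eq_top_of_isSmoothProjective_holds.supportedClasses_eq_span
    hS.1 (2 * 1) 1
  have horth : ∀ u ∈ k3FormRat.orthogonal NQ, ∀ d ∈ N, k3Form (fun j => (u j : ℂ)) (η d) = 0 := by
    intro u hu d hd
    rw [LinearMap.BilinForm.mem_orthogonal_iff] at hu
    have hd' : d ∈ Submodule.span ℂ {c : complexBetti S (2 * 1) |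
        IsRationalClass c ∧ c ∈ supportedClasses S (2 * 1) 1} := by
      rw [← hspan]; exact hd
    clear hd
    induction hd' using Submodule.span_induction with
    | mem d hd =>
      obtain ⟨w, hw⟩ := (hrat d).1 hd.1
      have hwN : w ∈ NQ := by
        rw [memNQ, ← hw, LinearEquiv.symm_apply_apply]
        exact hd.2
      rw [hw, k3Form_ratCast, k3FormRat_isSymm.eq, hu w hwN, Rat.cast_zero]
    | zero => rw [map_zero, k3Form_zero_right]
    | add c c' _ _ hc hc' => rw [map_add, k3Form_add_right, hc, hc', add_zero]
    | smul t c _ hc => rw [map_smul, k3Form_smul_right, hc, mul_zero]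
  -- `N_ℚ ∩ N_ℚ^⊥ = 0` (Hodge index)
  have hdisj : Disjoint NQ (k3FormRat.orthogonal NQ) := by
    rw [Submodule.disjoint_def]
    intro u huN huT
    have hc0 : η.symm (fun j => (u j : ℂ)) = 0 :=
      hND _ ((memNQ u).1 huN) ((hrat _).2 ⟨u, LinearEquiv.apply_symm_apply _ _⟩) fun d hd => by
        rw [hηcup, LinearEquiv.apply_symm_apply, horth u huT d hd, zero_smul]
    apply ratCastΛ_injective
    rw [ratCastΛ_zero]
    exact η.symm.injective (hc0.trans (map_zero _).symm)
  have hc := isCompl_orthogonal hdisj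
  -- the transcendental Hodge structure, irreducible of K3 type, polarized
  set H := hodgeT hN hdisj hxx hxpos with hH
  have hK3 : H.IsOfK3Type := isOfK3Type_hodgeT hN hdisj hxx hxpos
  have hirr : H.IsIrreducible := isIrreducible_hodgeT hN hdisj hxx hxpos
  set ψ : H.Polarization := polT hN hdisj hxx hxpos hu with hψ
  obtain ⟨hFld, ε, hεinj, hε⟩ := Zarhin1983_endAlg_isField_holds H hirr hK3
  -- `dim_ℚ N_ℚ ≥ dim_ℂ N ≥ 17`, hence `dim_ℚ T ≤ 5`
  have hdimN : Module.finrank ℂ ↥N ≤ Module.finrank ℚ ↥NQ := by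
    let b := Module.finBasis ℚ NQ
    let c : Fin (Module.finrank ℚ ↥NQ) → complexBetti S (2 * 1) :=
      fun i => η.symm (fun j => (((b i : NQ) : K3Index → ℚ) j : ℂ))
    have hle : N ≤ Submodule.span ℂ (Set.range c) := by
      intro d hd
      have hd' : d ∈ Submodule.span ℂ {c : complexBetti S (2 * 1) |
          IsRationalClass c ∧ c ∈ supportedClasses S (2 * 1) 1} := by
        rw [← hspan]; exact hd
      refine Submodule.span_le.2 ?_ hd'
      rintro d ⟨hdQ, hdN⟩
      obtain ⟨w, hw⟩ := (hrat d).1 hdQ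
      have hwN : w ∈ NQ := by
        rw [memNQ, ← hw, LinearEquiv.symm_apply_apply]
        exact hdN
      have hd_eq : d = η.symm (fun j => (w j : ℂ)) := by rw [← hw, LinearEquiv.symm_apply_apply]
      have hw_eq : (w : K3Index → ℚ) = ∑ i, (b.repr ⟨w, hwN⟩ i) • ((b i : NQ) : K3Index → ℚ) := by
        have h := congrArg (fun t : NQ => (t : K3Index → ℚ)) (b.sum_repr ⟨w, hwN⟩).symm
        simpa only [Submodule.coe_sum, Submodule.coe_smul] using h
      rw [SetLike.mem_coe, hd_eq, hw_eq, ratCastΛ_sum, map_sum]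
      refine Submodule.sum_mem _ fun i _ => ?_
      rw [ratCastΛ_smul, map_smul]
      exact Submodule.smul_mem _ _ (Submodule.subset_span ⟨i, rfl⟩)
    haveI : Module.Finite ℂ ↥(Submodule.span ℂ (Set.range c)) :=
      Module.Finite.span_of_finite ℂ (Set.finite_range c)
    exact (Submodule.finrank_mono hle).trans ((finrank_range_le_card c).trans (by simp))
  have hdimΛ : Module.finrank ℚ (K3Index → ℚ) = 22 := by
    rw [Module.finrank_fintype_fun_eq_card]
    simp [Fintype.card_sum, Fintype.card_fin]
  have hdimT : Module.finrank ℚ ↥(k3FormRat.orthogonal NQ) ≤ 5 := by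
    have h := Submodule.finrank_add_eq_of_isCompl hc
    omega
  -- van Geemen + Zarhin: `E = ℚ` or a non-real embedding
  rcases Vangeemen2008_three_mul_finrank_endAlg_le_holds.endAlg_eq_bot_or_exists_conj_ne hirr hK3 ψ hFld
    hdimT with hbot | ⟨φ', a, hφ'a⟩
  · -- `E = ℚ`: every rational Hodge endomorphism of `H²(S)` killing `N¹` is a rational scalar on `T`
    refine Or.inl fun f hf_rat hf_typ _ _ => ?_
    obtain ⟨φ, hφM, hφx, hφ11⟩ := anchorExistence_cmFloor_exists_ratEnd hHT hS η p₀ hp₀ hηint hηcup x hx20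
      hx20' hxne f hf_rat hf_typ
    have hφT : ∀ t ∈ k3FormRat.orthogonal NQ, φ t ∈ k3FormRat.orthogonal NQ :=
      fun t ht => map_mem_T hN φ hφx ht
    have hmem : φ.restrict hφT ∈ H.endAlg := restrict_mem_endAlg hN hdisj hxx hxpos φ hφT hφx hφ11
    rw [hbot, Algebra.mem_bot] at hmem
    obtain ⟨a, ha⟩ := hmem
    refine ⟨a, fun y hy => ?_⟩
    -- `η y ⊥ N_ℚ`, so `η y ∈ T_ℂ`
    have hzN : ∀ n ∈ NQ, k3Form (η y) (fun i => (n i : ℂ)) = 0 := by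
      intro n hn
      have h := hy _ ((memNQ n).1 hn)
      rw [hηcup, LinearEquiv.apply_symm_apply] at h
      exact hsmul0 h
    have hz0 : cxEnd (NQ.projection _ hc) (η y) = 0 := cxEnd_projection_eq_zero hdisj hzN
    have hz : iota _ (lam hc (η y)) = η y := iota_lam_of_proj_eq_zero hc hz0
    have hφz : cxEnd φ (η y) = (a : ℂ) • η y := by
      conv_lhs => rw [← hz]
      rw [← iota_baseChange_restrict φ hφT, ← ha, Algebra.algebraMap_eq_smul_one, LinearMap.baseChange_smul,
        LinearMap.smul_apply, Module.End.one_eq_id, LinearMap.baseChange_id, LinearMap.id_apply,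
        ← AnchorExistenceCMFloor.ratCast_smul_eq, map_smul, hz]
    have hfy : f y = η.symm (cxEnd φ (η y)) := by
      rw [hφM, LinearMap.comp_apply, LinearMap.comp_apply, LinearEquiv.coe_coe, LinearEquiv.coe_coe,
        LinearEquiv.symm_apply_apply, LinearEquiv.symm_apply_apply]
    rw [hfy, hφz, map_smul, LinearEquiv.symm_apply_apply]
  · -- CM: an element of `End_Hdg(T)` with a non-real eigenvalue on `ω`, extended by `id_N`
    right
    obtain ⟨hadjex, hadjconj⟩ := Zarhin1983_adjoint_eq_conj_holds H hirr hK3 ψ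
    obtain ⟨a', ha'⟩ := hadjex a
    have hne : a' ≠ a := by
      intro h
      apply hφ'a
      have key := hadjconj a a' ha' φ'
      rw [h] at key
      exact key.symm
    set μ : ℂ := ε a with hμdef
    have hμ : μ.im ≠ 0 := by
      intro him
      apply hne
      apply hεinj
      have key := hadjconj a a' ha' ε.toRingHom
      change ε a' = starRingEnd ℂ (ε a) at key
      rw [key, ← hμdef]
      exact Complex.conj_eq_iff_im.2 him
    -- the extension `û = a ⊕ id_N` and its eigenvalue on `x`
    have hamem : ((a : H.endAlg) : Module.End ℚ ↥(k3FormRat.orthogonal NQ)) ∈ H.endAlg := a.2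
    set û : Module.End ℚ (K3Index → ℚ) := extendT hdisj (a : Module.End ℚ ↥(k3FormRat.orthogonal NQ)) with hû
    have hω : omega x hdisj ∈ H.piece 2 0 := (mem_piece_two_zero_ofPeriod _ _).2 ⟨1, one_smul _ _⟩
    have hûx : cxEnd û x = μ • x := by
      have h := hε a (omega x hdisj) hω
      have h2 := congrArg (iota (k3FormRat.orthogonal NQ)) h
      rw [iota_baseChange hdisj, iota_omega hN hdisj, map_smul, iota_omega hN hdisj] at h2
      exact h2
    have hû11 : ∀ z : K3Index → ℂ, k3Form z x = 0 → k3Form z (star x) = 0 →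
        k3Form (cxEnd û z) x = 0 ∧ k3Form (cxEnd û z) (star x) = 0 :=
      fun z hzx hzx' => k3Form_cxEnd_extendT hN hdisj hxx hxpos hamem hzx hzx'
    -- the endomorphism of `H²(S)`
    let Ψ : complexBetti S (2 * 1) →ₗ[ℂ] complexBetti S (2 * 1) :=
      η.symm.toLinearMap ∘ₗ cxEnd û ∘ₗ η.toLinearMap
    have hΨapp : ∀ y, Ψ y = η.symm (cxEnd û (η y)) := fun y => rfl
    have hΨrat : ∀ y, IsRationalClass y → IsRationalClass (Ψ y) := by
      intro y hy
      obtain ⟨w, hw⟩ := (hrat y).1 hy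
      rw [hΨapp, hw, cxEnd_ratCast]
      exact (hrat _).2 ⟨û w, LinearEquiv.apply_symm_apply _ _⟩
    have hΨσ : Ψ σ = μ • σ := by rw [hΨapp, hησ, hûx, map_smul]
    have hΨtyp : ∀ (i j : ℕ) y, IsOfHodgeType 2 S (2 * 1) i j y → IsOfHodgeType 2 S (2 * 1) i j (Ψ y) := by
      refine typePreserving_of_lines hHT hS hx20 hxne Ψ ⟨μ, hΨσ⟩ ⟨star μ, ?_⟩ fun v hv => ?_
      · rw [hσbar, hΨapp, LinearEquiv.apply_symm_apply, cxEnd_star, hûx, star_smul, map_smul]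
      · have hv' := hv
        rw [← LinearEquiv.symm_apply_apply η v, h11_iff] at hv'
        rw [hΨapp, h11_iff]
        exact hû11 (η v) hv'.1 hv'.2
    exact ⟨Ψ, hΨrat, hΨtyp, σ, μ, hx20, hxne, hμ, hΨσ⟩

/-! ### The Hodge conjecture for `S × S`, `ρ(S) ≥ 17` -/

/-- **The Hodge conjecture for `S ⊗ S`, `S` a projective K3 surface of Picard number `≥ 17`, modulo
Buskin's Thm. 1.1 and the existence of markings.** `End_Hdg(T(S)) = ℚ` (the tree theorem
`hodgeConjectureFor_square_of_hodgeEndomorphisms_scalar`) or `S` has complex multiplication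
(`CMThird.hodgeConjectureFor_square_of_CM_of_buskin`), by
`scalar_or_hasComplexMultiplication_of_seventeen_le`. [cite: Vangeemen2008, Lemma 3.2]
[cite: Buskin2019, Thm. 1.1 and Corollary] [cite: Huybrechts2019, Cor. 0.4 (ii)] -/
theorem hodgeConjectureFor_square_of_seventeen_le (hB : Buskin2019_hodgeIsometry_algebraic)
    (hmark : Huybrechts_K3_marking_exists) (hS : IsK3Surface S)
    (hρ : 17 ≤ Module.finrank ℂ ↥(algebraicClasses S 1)) : HodgeConjectureFor 4 (S ⊗ S) := by
  rcases scalar_or_hasComplexMultiplication_of_seventeen_le hmark hS hρ with hQ | hCM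
  · exact SquareGlueFree.hodgeConjectureFor_square_of_hodgeEndomorphisms_scalar hS.isSmoothProjective hQ
  · exact CMThird.hodgeConjectureFor_square_of_CM_of_buskin hB hmark S hS hCM

/-- **Route ELineTransport's support item `HighPicardSquares` (stmt-HodgeConjecture-12553) modulo
Buskin's Thm. 1.1 and markings**: HC for `S × S` for every projective K3 surface (the item's K3
clause is `IsK3Surface S` verbatim) of Picard number `≥ 17`. [cite: Vangeemen2008, Lemma 3.2]
[cite: Buskin2019, Thm. 1.1 and Corollary] -/
theorem highPicardSquares_of_buskin (hB : Buskin2019_hodgeIsometry_algebraic)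
    (hmark : Huybrechts_K3_marking_exists) :
    Summit.HodgeConjecture.HodgeConjecture.Theses.ELineTransport.HighPicardSquares :=
  fun S hS hρ => hodgeConjectureFor_square_of_seventeen_le hB hmark (S := S) hS hρ

/-! ### The crux reduced to the RM third at Picard numbers `3 ≤ ρ ≤ 16` -/

/-- **`PicardThreeK3Squares` from the cycle-induced sector clause on non-CM, non-scalar K3 surfaces
with `3 ≤ ρ(S) ≤ 16`**, granted Buskin's Thm. 1.1 and markings: at `ρ(S) ≥ 17` there is no real
multiplication (`scalar_or_hasComplexMultiplication_of_seventeen_le`), so the hypothesis `hRM` of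
`CMThird.picardThreeK3Squares_of_realMultiplicationThird` is only needed for `ρ(S) ≤ 16`.
[cite: Vangeemen2008, Lemma 3.2] [cite: Varesco2023, §2 (p. 8)] [cite: Buskin2019, Thm. 1.1] -/
theorem picardThreeK3Squares_of_realMultiplicationThird_le_sixteen (hB : Buskin2019_hodgeIsometry_algebraic)
    (hmark : Huybrechts_K3_marking_exists)
    (hRM : ∀ (S : SchemeOver ℂ) (hS : IsK3Surface S), ¬ HasComplexMultiplication S →
      3 ≤ Module.finrank ℂ ↥(algebraicClasses S 1) → Module.finrank ℂ ↥(algebraicClasses S 1) ≤ 16 →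
      (¬ ∀ (f : complexBetti S (2 * 1) →ₗ[ℂ] complexBetti S (2 * 1)),
        (∀ y, IsRationalClass y → IsRationalClass (f y)) →
        (∀ (i j : ℕ) y, IsOfHodgeType 2 S (2 * 1) i j y → IsOfHodgeType 2 S (2 * 1) i j (f y)) →
        (∀ d ∈ algebraicClasses S 1, f d = 0) →
        (∀ y : complexBetti S (2 * 1), ∀ d ∈ algebraicClasses S 1,
          cupProduct (rfl : 2 * 1 + 2 * 1 = 2 * 2) (f y) d = 0) →
        ∃ a : ℚ, ∀ y : complexBetti S (2 * 1),
          (∀ d ∈ algebraicClasses S 1, cupProduct (rfl : 2 * 1 + 2 * 1 = 2 * 2) y d = 0) →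
            f y = (a : ℂ) • y) →
      ∀ (f : complexBetti S (2 * 1) →ₗ[ℂ] complexBetti S (2 * 1)),
        (∀ y, IsRationalClass y → IsRationalClass (f y)) →
        (∀ (i j : ℕ) y, IsOfHodgeType 2 S (2 * 1) i j y → IsOfHodgeType 2 S (2 * 1) i j (f y)) →
        (∀ d ∈ algebraicClasses S 1, f d = 0) →
        (∀ y : complexBetti S (2 * 1), ∀ d ∈ algebraicClasses S 1,
          cupProduct (rfl : 2 * 1 + 2 * 1 = 2 * 2) (f y) d = 0) →
        ∃ g : complexBetti S (2 * 1) →ₗ[ℂ] complexBetti S (2 * 1),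
          (∀ d ∈ algebraicClasses S 1, g d ∈ algebraicClasses S 1) ∧
          (∃ γ ∈ algebraicClasses (S ⊗ S) 2, ∀ y : complexBetti S (2 * 1),
            g y = Corr[complexOrientationFamily, hS.isSmoothProjective ; γ, y]) ∧
          ∀ y : complexBetti S (2 * 1),
            (∀ d ∈ algebraicClasses S 1, cupProduct (rfl : 2 * 1 + 2 * 1 = 2 * 2) y d = 0) →
              f y = g y) :
    Summit.HodgeConjecture.HodgeConjecture.Theses.MarkmanPartnerTransport.PicardThreeK3Squares := by
  intro S hS η p x _ hρ
  by_cases h17 : 17 ≤ Module.finrank ℂ ↥(algebraicClasses S 1)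
  · exact hodgeConjectureFor_square_of_seventeen_le hB hmark hS h17
  by_cases hCM : HasComplexMultiplication S
  · exact CMThird.hodgeConjectureFor_square_of_CM_of_buskin hB hmark S hS hCM
  · by_cases hQ : ∀ (f : complexBetti S (2 * 1) →ₗ[ℂ] complexBetti S (2 * 1)),
        (∀ y, IsRationalClass y → IsRationalClass (f y)) →
        (∀ (i j : ℕ) y, IsOfHodgeType 2 S (2 * 1) i j y → IsOfHodgeType 2 S (2 * 1) i j (f y)) →
        (∀ d ∈ algebraicClasses S 1, f d = 0) →
        (∀ y : complexBetti S (2 * 1), ∀ d ∈ algebraicClasses S 1,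
          cupProduct (rfl : 2 * 1 + 2 * 1 = 2 * 2) (f y) d = 0) →
        ∃ a : ℚ, ∀ y : complexBetti S (2 * 1),
          (∀ d ∈ algebraicClasses S 1, cupProduct (rfl : 2 * 1 + 2 * 1 = 2 * 2) y d = 0) →
            f y = (a : ℂ) • y
    · exact SquareGlueFree.hodgeConjectureFor_square_of_hodgeEndomorphisms_scalar hS.isSmoothProjective hQ
    · exact CycleInducedSector.hodgeConjectureFor_square_of_cycleInducedSector complexOrientationFamily
        hS.isSmoothProjective (hRM S hS hCM hρ (by omega) hQ)

end Summit.HodgeConjecture.HodgeConjecture.Theorems.MarkmanPartnerTransport.HighPicard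

end
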